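import Summits.CriticalPhenomena.PercolationContinuityZ3.Theorems.PercNearOneGluingNoHeavyLowerTailSahiGridPatternZeroLocus
import Summits.CriticalPhenomena.PercolationContinuityZ3.Theorems.PercNearOneGluingNoHeavyLowerTailSahiGridPatternShadowTPP

/-!
# `NoHeavyLowerTail` (crux stmt-CriticalPhenomena-4575), Sahi programme P1: **THE ZERO LOCUS OF THE THREE-PARTITION FUNCTIONAL** —
# Boolean shadow of `…SahiGridPatternZeroLocus`: `N(𝒰,𝒱,𝒲) = 0` for an independent pair and a block-saturated third family

Support file (Sahi cell, seat `prim-sahi-p1`, generation 14; `--supports stmt-CriticalPhenomena-4575`).  Pure proofs, no definitions, no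
`sorry`, standard axioms.  Vocabulary: `…SahiGridPatternZeroLocus` (`sStarD_eq_zero_of_indepSlots_saturated`), `…SahiGridPatternShadowTPP`
(`sStarD_shadow_eq`: the Boolean shadow of the pattern functional is `2^d ·` the three-partition functional `threePartN` of
`…ThreePartitionAD`).

THE MATHEMATICS.  For families `𝒰, 𝒱, 𝒲 ⊆ 𝒫([d])` (NO up-set hypothesis) the three-partition functional is
`N(𝒰,𝒱,𝒲) = 2·top(𝒰∩𝒱∩𝒲) + tee(𝒰,𝒱,𝒲) − dee(𝒰,𝒱∩𝒲) − dee(𝒱,𝒰∩𝒲) − dee(𝒲,𝒰∩𝒱)` (counts of ordered 3-partitions of `[d]`).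
**THEOREM (`threePartN_eq_zero_of_indep_saturated`, every `d`).**  Let `I, J ⊆ [d]` be disjoint; suppose membership in `𝒰` depends only
on `S ∩ I`, membership in `𝒱` only on `S ∩ J`, membership in `𝒲` is unchanged when a member of `𝒱` is altered inside `I`, and unchanged when
a member of `𝒰` is altered inside `J`.  Then `N(𝒰,𝒱,𝒲) = 0`.  (Transfer of the pattern-side identity along the shadow bridge.)
COROLLARIES: three mutually independent families (`threePartN_eq_zero_of_threeIndep`); `𝒰 ∪ 𝒱 ⊆ 𝒲` with `𝒰 ⊥ 𝒱`
(`threePartN_eq_zero_of_indep_union_subset`).  CENSUS (generation-14 memo): for up-families this hypothesis (up to permuting the three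
slots) describes ALL `4 704` ordered zero triples with three nonempty proper families at `d = 4` and every sampled zero at `d = 5, 6`;
CONJECTURE: it is the whole zero locus of three-partition positivity.  HONEST LABEL: identities only; `ThreePartitionPositivity`,
`PatternPos d` (`d ≥ 5`), Sahi's `C₃` and Kahn's conjecture remain OPEN. [this work]
-/

noncomputable section

open Finset
open scoped Classical

namespace Summit.CriticalPhenomena.PercolationContinuityZ3.Theorems.SahiGridPattern

open Summit.CriticalPhenomena.PercolationContinuityZ3.Theorems.ThreePartition

variable {d : ℕ}

/-- **THE THREE-PARTITION FUNCTIONAL VANISHES ON THE SATURATED INDEPENDENT-PAIR FAMILY** (every `d`, no up-set hypothesis): if membership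
in `𝒰` depends only on `S ∩ I`, membership in `𝒱` only on `S ∩ J` (`I ∩ J = ∅`), and membership in `𝒲` is invariant under changing a member of
`𝒱` inside `I` and under changing a member of `𝒰` inside `J`, then `threePartN 𝒰 𝒱 𝒲 = 0`. [this work] -/
theorem threePartN_eq_zero_of_indep_saturated (I J : Finset (Fin d)) (hIJ : Disjoint I J) {𝒰 𝒱 𝒲 : Set (Set (Fin d))}
    (hdep𝒰 : ∀ S T : Set (Fin d), (∀ a ∈ I, (a ∈ S ↔ a ∈ T)) → (S ∈ 𝒰 ↔ T ∈ 𝒰))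
    (hdep𝒱 : ∀ S T : Set (Fin d), (∀ a ∈ J, (a ∈ S ↔ a ∈ T)) → (S ∈ 𝒱 ↔ T ∈ 𝒱))
    (hsat𝒱 : ∀ S T : Set (Fin d), (∀ a ∉ I, (a ∈ S ↔ a ∈ T)) → S ∈ 𝒱 → (S ∈ 𝒲 ↔ T ∈ 𝒲))
    (hsat𝒰 : ∀ S T : Set (Fin d), (∀ a ∉ J, (a ∈ S ↔ a ∈ T)) → S ∈ 𝒰 → (S ∈ 𝒲 ↔ T ∈ 𝒲)) :
    threePartN 𝒰 𝒱 𝒲 = 0 := by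
  have h := sStarD_eq_zero_of_indepSlots_saturated I J hIJ
    (A := univ.filter fun x : Pd d => {a : Fin d | x a = 2} ∈ 𝒰)
    (B := univ.filter fun x : Pd d => {a : Fin d | x a = 2} ∈ 𝒱)
    (C := univ.filter fun x : Pd d => {a : Fin d | x a = 2} ∈ 𝒲)
    (fun x y hxy => by
      rw [Finset.mem_filter, Finset.mem_filter]
      simp only [Finset.mem_univ, true_and]
      exact hdep𝒰 _ _ fun a ha => by simp [hxy a ha])
    (fun x y hxy => by
      rw [Finset.mem_filter, Finset.mem_filter]
      simp only [Finset.mem_univ, true_and]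
      exact hdep𝒱 _ _ fun a ha => by simp [hxy a ha])
    (fun x y hxy hx => by
      rw [Finset.mem_filter, Finset.mem_filter]
      rw [Finset.mem_filter] at hx
      simp only [Finset.mem_univ, true_and] at hx ⊢
      exact hsat𝒱 _ _ (fun a ha => by simp [hxy a ha]) hx)
    (fun x y hxy hx => by
      rw [Finset.mem_filter, Finset.mem_filter]
      rw [Finset.mem_filter] at hx
      simp only [Finset.mem_univ, true_and] at hx ⊢
      exact hsat𝒰 _ _ (fun a ha => by simp [hxy a ha]) hx)
  rw [sStarD_shadow_eq 𝒰 𝒱 𝒲 (fun x => by simp) (fun x => by simp) (fun x => by simp)] at h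
  have h2 : (2 : ℤ) ^ d ≠ 0 := pow_ne_zero _ (by norm_num)
  exact (mul_eq_zero.1 h).resolve_left h2

/-- **Three mutually independent families** (every `d`): `𝒰`, `𝒱`, `𝒲` depending on `S ∩ I`, `S ∩ J`, `S ∖ (I ∪ J)` only (`I ∩ J = ∅`) have
`threePartN 𝒰 𝒱 𝒲 = 0`. [this work] -/
theorem threePartN_eq_zero_of_threeIndep (I J : Finset (Fin d)) (hIJ : Disjoint I J) {𝒰 𝒱 𝒲 : Set (Set (Fin d))}
    (hdep𝒰 : ∀ S T : Set (Fin d), (∀ a ∈ I, (a ∈ S ↔ a ∈ T)) → (S ∈ 𝒰 ↔ T ∈ 𝒰))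
    (hdep𝒱 : ∀ S T : Set (Fin d), (∀ a ∈ J, (a ∈ S ↔ a ∈ T)) → (S ∈ 𝒱 ↔ T ∈ 𝒱))
    (hdep𝒲 : ∀ S T : Set (Fin d), (∀ a, a ∉ I → a ∉ J → (a ∈ S ↔ a ∈ T)) → (S ∈ 𝒲 ↔ T ∈ 𝒲)) :
    threePartN 𝒰 𝒱 𝒲 = 0 :=
  threePartN_eq_zero_of_indep_saturated I J hIJ hdep𝒰 hdep𝒱
    (fun S T h _ => hdep𝒲 S T fun a haI _ => h a haI)
    (fun S T h _ => hdep𝒲 S T fun a _ haJ => h a haJ)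

/-- **The 'coefficientwise zero' family of the three-partition functional** (every `d`): an independent pair `𝒰` (depends on `S ∩ I`), `𝒱`
(depends on `S ∩ J`, `I ∩ J = ∅`) and ANY family `𝒲 ⊇ 𝒰 ∪ 𝒱` give `threePartN 𝒰 𝒱 𝒲 = 0`. [this work] -/
theorem threePartN_eq_zero_of_indep_union_subset (I J : Finset (Fin d)) (hIJ : Disjoint I J) {𝒰 𝒱 𝒲 : Set (Set (Fin d))}
    (hdep𝒰 : ∀ S T : Set (Fin d), (∀ a ∈ I, (a ∈ S ↔ a ∈ T)) → (S ∈ 𝒰 ↔ T ∈ 𝒰))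
    (hdep𝒱 : ∀ S T : Set (Fin d), (∀ a ∈ J, (a ∈ S ↔ a ∈ T)) → (S ∈ 𝒱 ↔ T ∈ 𝒱))
    (h𝒰𝒲 : 𝒰 ⊆ 𝒲) (h𝒱𝒲 : 𝒱 ⊆ 𝒲) : threePartN 𝒰 𝒱 𝒲 = 0 := by
  refine threePartN_eq_zero_of_indep_saturated I J hIJ hdep𝒰 hdep𝒱 (fun S T h hS => ?_) (fun S T h hS => ?_)
  · have hT : T ∈ 𝒱 := (hdep𝒱 S T fun a ha => h a (fun haI => Finset.disjoint_left.1 hIJ haI ha)).1 hS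
    exact ⟨fun _ => h𝒱𝒲 hT, fun _ => h𝒱𝒲 hS⟩
  · have hT : T ∈ 𝒰 := (hdep𝒰 S T fun a ha => h a (fun haJ => Finset.disjoint_left.1 hIJ ha haJ)).1 hS
    exact ⟨fun _ => h𝒰𝒲 hT, fun _ => h𝒰𝒲 hS⟩

end Summit.CriticalPhenomena.PercolationContinuityZ3.Theorems.SahiGridPattern
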